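import Literature.Probability.LatticeModels.SpinWaveComplexStability
import Literature.Probability.LatticeModels.BackboneCurrent
import Literature.MathematicalPhysics.QuantumLattice.LatticeToriProofs
import HarnessLib

/-!
# Spin-wave complex stability on the discrete torus `(ℤ/Lℤ)³`, uniformly in `L`

Topic `Probability/LatticeModels`; sequel to `SpinWaveComplexStability.lean`. The admissible
kernel class of crux `Summit.HubbardSuperconductivity.HubbardSuperconductivity.Theses.NodalWardXY.PerturbedXYOrder`
is `‖K(b,b')‖ ≤ ε (1 + dist(x,x'))⁻⁴` for directed bonds `b = (x,i)`, `b' = (x',i')` of the torus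
`(ℤ/Lℤ)³`, `dist` the graph distance of `torusGraph 3 L`. We prove that its SCHUR NORM is bounded
uniformly in the side `L`:

  `Σ_{b'} ‖K(b,b')‖ ≤ 144 ε` and `Σ_{b} ‖K(b,b')‖ ≤ 144 ε`   (`row_sum_norm_le_of_admissible`,
  `col_sum_norm_le_of_admissible`),

via `dist ≥` the periodic `ℓ^∞` distance (`torusDist_le_dist`, a `1`-Lipschitz/walk induction),
radial summation with the sphere bound `#{torusDist = r} ≤ 6(2r+1)²`
(`Literature.MathematicalPhysics.QuantumLattice.sum_radial_le`, `card_filter_torusDist_eq_le`) and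
`Σ_r 6(2r+1)²(1+r)⁻⁴ ≤ 24 Σ_r (1+r)⁻² ≤ 48`. Consequently
(`integral_cexp_spinWave_torus_ne_zero`) the spin-wave (Gaussian) caricature of that crux is
ZERO-FREE UNIFORMLY IN `L`: for every injective real gradient matrix `D` on the bonds, every
stiffness `J > 288 ε` and every admissible `K`,
`∫ exp(−(J/2)‖Dφ‖² + Σ K(b,b')(Dφ)_b(Dφ)_{b'}) dφ ≠ 0`
(`integral_cexp_spinWave_twoGradient_ne_zero` with `κ = 144 ε`). This is the Gaussian level of the
crux's open "complex stability" stub (`Cruxes/PerturbedXYOrder/Disproof.lean` §5.3: "radius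
`J > 2 ε S_∞`"); the constant `144` is crude (`S_∞ ≈ 7.4` numerically).
-/

noncomputable section

namespace Literature.Probability.LatticeModels

open MeasureTheory Matrix Complex Finset Literature.MathematicalPhysics.QuantumLattice
open scoped BigOperators Real

/-! ### Graph distance on the torus dominates the periodic `ℓ^∞` distance -/

section Dist

variable {d L : ℕ} [NeZero L]

/-- Every site of `(ℤ/Lℤ)^d` is reachable from every other in `torusGraph d L` (`L ≥ 1`).
[folklore] -/
theorem torusGraph_reachable (x y : TorusSite d L) : (torusGraph d L).Reachable x y := by
  have hx : Torus.proj L (fun i => ((x i).val : ℤ)) = x := by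
    funext i; simp only [Torus.proj_apply, Int.cast_natCast, ZMod.natCast_zmod_val]
  have hy : Torus.proj L (fun i => ((y i).val : ℤ)) = y := by
    funext i; simp only [Torus.proj_apply, Int.cast_natCast, ZMod.natCast_zmod_val]
  have h := torusGraph_reachable_proj (d := d) L (fun i => ((x i).val : ℤ)) (fun i => ((y i).val : ℤ))
  rwa [hx, hy] at h

/-- The periodic `ℓ^∞` distance is at most the length of any walk in the torus graph (each step
changes it by at most `1`). [folklore] -/
theorem torusDist_le_walk_length {x y : TorusSite d L} (p : (torusGraph d L).Walk x y) :
    torusDist x y ≤ p.length := by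
  induction p with
  | nil => simp
  | cons h p ih =>
      rename_i u v w
      calc torusDist u w ≤ torusDist u v + torusDist v w := torusDist_triangle' u v w
        _ ≤ 1 + p.length := add_le_add (torusDist_le_one_of_adj h) ih
        _ = (SimpleGraph.Walk.cons h p).length := by rw [SimpleGraph.Walk.length_cons, add_comm]

/-- **`torusDist x y ≤ dist x y`**: the graph distance of the torus dominates the periodic `ℓ^∞`
distance. [folklore] -/
theorem torusDist_le_dist (x y : TorusSite d L) : torusDist x y ≤ (torusGraph d L).dist x y := by
  obtain ⟨p, hp⟩ := (torusGraph_reachable x y).exists_walk_length_eq_dist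
  rw [← hp]
  exact torusDist_le_walk_length p

end Dist

/-! ### The lattice sum `Σ_{x'} (1 + dist(x,x'))⁻⁴ ≤ 48` on `(ℤ/Lℤ)³`, uniformly in `L` -/

section LatticeSum

variable {L : ℕ} [NeZero L]

/-- `Σ_{r < n} (1+r)⁻² ≤ 2` (indeed `≤ 2 − 1/n`). [folklore] -/
theorem sum_range_inv_one_add_sq_le (n : ℕ) : ∑ r ∈ range n, (1 : ℝ) / (1 + (r : ℝ)) ^ 2 ≤ 2 := by
  suffices h : ∀ n : ℕ, 1 ≤ n → ∑ r ∈ range n, (1 : ℝ) / (1 + (r : ℝ)) ^ 2 ≤ 2 - 1 / (n : ℝ) by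
    rcases Nat.eq_zero_or_pos n with rfl | hn
    · simp
    · exact le_trans (h n hn) (by simp only [one_div, tsub_le_iff_right, le_add_iff_nonneg_right, inv_nonneg,
        Nat.cast_nonneg])
  intro n hn
  induction n, hn using Nat.le_induction with
  | base => norm_num
  | succ n hn ih =>
      rw [Finset.sum_range_succ]
      have hn' : (1 : ℝ) ≤ n := by exact_mod_cast hn
      have key : (1 : ℝ) / (1 + (n : ℝ)) ^ 2 ≤ 1 / (n : ℝ) - 1 / ((n : ℝ) + 1) := by
        rw [div_sub_div _ _ (by positivity) (by positivity)]
        rw [div_le_div_iff₀ (by positivity) (by positivity)]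
        nlinarith
      calc ∑ r ∈ range n, (1 : ℝ) / (1 + (r : ℝ)) ^ 2 + 1 / (1 + (n : ℝ)) ^ 2
          ≤ (2 - 1 / (n : ℝ)) + (1 / (n : ℝ) - 1 / ((n : ℝ) + 1)) := add_le_add ih key
        _ = 2 - 1 / ((n + 1 : ℕ) : ℝ) := by push_cast; ring

/-- The radial weights of `(ℤ/Lℤ)³`: `Σ_{r<L} 6(2r+1)² (1+r)⁻⁴ ≤ 48`. [folklore] -/
theorem sum_range_sphere_mul_inv_pow_four_le (L : ℕ) :
    ∑ r ∈ range L, ((3 * (2 * (2 * r + 1) ^ (3 - 1)) : ℕ) : ℝ) * (1 / (1 + (r : ℝ)) ^ 4) ≤ 48 := by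
  calc ∑ r ∈ range L, ((3 * (2 * (2 * r + 1) ^ (3 - 1)) : ℕ) : ℝ) * (1 / (1 + (r : ℝ)) ^ 4)
      ≤ ∑ r ∈ range L, 24 * (1 / (1 + (r : ℝ)) ^ 2) := by
        refine Finset.sum_le_sum fun r _ => ?_
        have hr : (0 : ℝ) ≤ r := Nat.cast_nonneg r
        have h1 : (0 : ℝ) < 1 + r := by positivity
        rw [show (3 - 1 : ℕ) = 2 from rfl]
        push_cast
        rw [mul_one_div, mul_one_div, div_le_div_iff₀ (by positivity) (by positivity)]
        nlinarith [pow_pos h1 2, pow_pos h1 4]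
    _ = 24 * ∑ r ∈ range L, 1 / (1 + (r : ℝ)) ^ 2 := by rw [Finset.mul_sum]
    _ ≤ 24 * 2 := by gcongr; exact sum_range_inv_one_add_sq_le L
    _ = 48 := by norm_num

/-- **Uniform lattice sum on `(ℤ/Lℤ)³`**: `Σ_{x'} (1 + dist(x,x'))⁻⁴ ≤ 48` for every `L ≥ 1`
(graph distance of `torusGraph 3 L`). [folklore] -/
theorem sum_inv_one_add_dist_pow_four_le (x : TorusSite 3 L) :
    ∑ x' : TorusSite 3 L, (1 : ℝ) / (1 + ((torusGraph 3 L).dist x x' : ℝ)) ^ 4 ≤ 48 := by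
  -- graph distance ≥ periodic ℓ^∞ distance, and the weight is antitone in the distance
  have hmono : ∀ x' : TorusSite 3 L, (1 : ℝ) / (1 + ((torusGraph 3 L).dist x x' : ℝ)) ^ 4 ≤
      1 / (1 + (torusDist x' x : ℝ)) ^ 4 := by
    intro x'
    have h := torusDist_le_dist x x'
    rw [torusDist_comm'] at h
    have h' : (torusDist x' x : ℝ) ≤ ((torusGraph 3 L).dist x x' : ℝ) := by exact_mod_cast h
    have h0 : (0 : ℝ) ≤ torusDist x' x := Nat.cast_nonneg _
    exact one_div_le_one_div_of_le (by positivity) (by gcongr)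
  refine le_trans (Finset.sum_le_sum fun x' _ => hmono x') ?_
  -- radial summation with the sphere bound
  have hrad := sum_radial_le (d := 3) (L := L) (fun r : ℕ => (1 : ℝ) / (1 + (r : ℝ)) ^ 4)
    (fun r => by positivity) x (fun r => card_filter_torusDist_eq_le (by norm_num) x r) (fun u => torusDist_lt u x)
  exact le_trans hrad (sum_range_sphere_mul_inv_pow_four_le L)

end LatticeSum

/-! ### Schur norm of an admissible two-current kernel, and spin-wave stability on the torus -/

section Torus

variable {L : ℕ} [NeZero L]

/-- **Row sums of an admissible kernel**: if `‖K(b,b')‖ ≤ ε (1 + dist(x,x'))⁻⁴` on the directed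
bonds of `(ℤ/Lℤ)³` then `Σ_{b'} ‖K(b,b')‖ ≤ 144 ε`, uniformly in `L`. [folklore] -/
theorem row_sum_norm_le_of_admissible {ε : ℝ} (K : (TorusSite 3 L × Fin 3) → (TorusSite 3 L × Fin 3) → ℂ)
    (hK : ∀ b b', ‖K b b'‖ ≤ ε / (1 + ((torusGraph 3 L).dist b.1 b'.1 : ℝ)) ^ 4)
    (b : TorusSite 3 L × Fin 3) : ∑ b', ‖K b b'‖ ≤ 144 * ε := by
  have hε : 0 ≤ ε := by
    have h := le_trans (norm_nonneg _) (hK b b)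
    rw [SimpleGraph.dist_self] at h
    simpa using h
  calc ∑ b', ‖K b b'‖ ≤ ∑ b' : TorusSite 3 L × Fin 3, ε / (1 + ((torusGraph 3 L).dist b.1 b'.1 : ℝ)) ^ 4 :=
        Finset.sum_le_sum fun b' _ => hK b b'
    _ = ∑ x' : TorusSite 3 L, ∑ _i : Fin 3, ε / (1 + ((torusGraph 3 L).dist b.1 x' : ℝ)) ^ 4 := by
        rw [← Finset.univ_product_univ, Finset.sum_product]
    _ = 3 * ε * ∑ x' : TorusSite 3 L, 1 / (1 + ((torusGraph 3 L).dist b.1 x' : ℝ)) ^ 4 := by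
        simp only [Finset.sum_const, Finset.card_univ, Fintype.card_fin, nsmul_eq_mul, Finset.mul_sum]
        exact Finset.sum_congr rfl fun x' _ => by push_cast; ring
    _ ≤ 3 * ε * 48 := by
        exact mul_le_mul_of_nonneg_left (sum_inv_one_add_dist_pow_four_le b.1) (by positivity)
    _ = 144 * ε := by ring

/-- **Column sums of an admissible kernel**: `Σ_{b} ‖K(b,b')‖ ≤ 144 ε`, uniformly in `L`.
[folklore] -/
theorem col_sum_norm_le_of_admissible {ε : ℝ} (K : (TorusSite 3 L × Fin 3) → (TorusSite 3 L × Fin 3) → ℂ)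
    (hK : ∀ b b', ‖K b b'‖ ≤ ε / (1 + ((torusGraph 3 L).dist b.1 b'.1 : ℝ)) ^ 4)
    (b' : TorusSite 3 L × Fin 3) : ∑ b, ‖K b b'‖ ≤ 144 * ε := by
  -- apply the row bound to the transposed kernel (the graph distance is symmetric)
  have hK' : ∀ c c' : TorusSite 3 L × Fin 3,
      ‖(fun c c' => K c' c) c c'‖ ≤ ε / (1 + ((torusGraph 3 L).dist c.1 c'.1 : ℝ)) ^ 4 := by
    intro c c'
    simpa [SimpleGraph.dist_comm] using hK c' c
  simpa using row_sum_norm_le_of_admissible (fun c c' => K c' c) hK' b'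

/-- **Spin-wave complex stability on the torus, uniformly in `L`.** For every side `L ≥ 1`, every
injective real gradient matrix `D` on the directed bonds of `(ℤ/Lℤ)³` (e.g. the pinned discrete
gradient), every stiffness `J > 288 ε` and every complex two-current kernel of the admissible class
`‖K(b,b')‖ ≤ ε(1 + dist(x,x'))⁻⁴`, the Gaussian (spin-wave) partition function tilted by
`W_K(φ) = Σ K(b,b') (Dφ)_b (Dφ)_{b'}` does not vanish. (Gaussian level of the complex-stability stub
of crux `…Theses.NodalWardXY.PerturbedXYOrder`; the radius `ε < J/288` is independent of `L`.)
[folklore] -/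
theorem integral_cexp_spinWave_torus_ne_zero {n : Type*} [Fintype n] [DecidableEq n]
    (D : Matrix (TorusSite 3 L × Fin 3) n ℝ) (hD : Function.Injective D.mulVec) {J ε : ℝ}
    (hJ : 288 * ε < J) (K : (TorusSite 3 L × Fin 3) → (TorusSite 3 L × Fin 3) → ℂ)
    (hK : ∀ b b', ‖K b b'‖ ≤ ε / (1 + ((torusGraph 3 L).dist b.1 b'.1 : ℝ)) ^ 4) :
    (∫ x : n → ℝ, cexp (-((J / 2 : ℝ) : ℂ) * ((∑ b, (D *ᵥ x) b ^ 2 : ℝ) : ℂ) +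
        ∑ b, ∑ b', K b b' * ((D *ᵥ x) b : ℂ) * ((D *ᵥ x) b' : ℂ))) ≠ 0 :=
  integral_cexp_spinWave_twoGradient_ne_zero D hD (κ := 144 * ε) (by linarith) K
    (row_sum_norm_le_of_admissible K hK) (col_sum_norm_le_of_admissible K hK)

end Torus

end Literature.Probability.LatticeModels

end
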